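/-
Copyright (c) 2026 the pub-hodgecm-mathlib formalisation cell (harness21).  Prover seat hodgecm-mathlib-K2E3-p03 (g7), HCML Track B «K2-LIT» ∕ h413
(`stmt-HodgeConjecture-24833`), leaf (nsc-S-A′), brick GEO-QB‴ (K2E3-p17 (g8)'s S4 census; route (T) «transport»), part 3 = THE HEAD: the Jacquet exponents of the
`P₁₂`-standard module `D′(x,y) = Ind_{P₁₂}(x ⊠ y∘det₂)`.  2026-09-04.
-/
import Summits.HodgeConjecture.HodgeConjecture.Theorems.K2E3GL3StandardModuleTransport          -- (this seat) (T-a) `exists_transportEquiv_D'`; brings part 1 `K2E3JacquetWeightTransport`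
import Summits.HodgeConjecture.HodgeConjecture.Theorems.K2E3GL3StandardModuleJacquetDimension   -- ★ GEO-QB (K2E5-p17): `finrank_weightSpace_D_eq`, `finiteDimensional_jacquet_D`
import HarnessLib

/-!
# K2_E3 road (h413), leaf (nsc-S-A′), brick GEO-QB‴ — THE EXPONENTS OF `D′(x,y) = Ind_{P₁₂}((x ⊠ y∘det₂)δ^{1∕2})`: `tch(x, yν½⁻¹, yν½)`, `tch(yν½⁻¹, x, yν½)`,
# `tch(yν½⁻¹, yν½, x)`, each with multiplicity one

Cell `pub/hodgecm-mathlib` (D-0151), Track B, seat K2E3-p03 (g7) (dealer K2E3-plan (g4) «=» 13:25:45Z; consumer K2E3-p17 (g8): IRR‴ ∕ NYA).  `--supports stmt-HodgeConjecture-24833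
--as helper`; THEOREMS ONLY (no `def`, no instance, no notation, no named fact, no `sorry`); never imports `Cruxes/…/Lines`.  COUNT-NEUTRAL.

THE MATHEMATICS ([BernsteinZelevinsky1977, §2.12, Thm. 5.2]; [Zelevinsky1980, §1.1, §1.2, Ex. 3.2]).  By (T-a) `D′(x,y) ≃ D(y⁻¹,x⁻¹)^θ` (`θ = gkAutomorphism`), by part 1 the Borel
Jacquet weights transport as `mult_{D′}(ζ) = mult_{D(y⁻¹,x⁻¹)}(ζ ∘ θ_T)` with `θ_T(t₀,t₁,t₂) = (t₂⁻¹,t₁⁻¹,t₀⁻¹)`, and ★ GEO-QB gives `E(D(y⁻¹,x⁻¹)) =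
{(y⁻¹ν½⁻¹, y⁻¹ν½, x⁻¹), (y⁻¹ν½⁻¹, x⁻¹, y⁻¹ν½), (x⁻¹, y⁻¹ν½⁻¹, y⁻¹ν½)}`; reversing and inverting (`tch(a,b,c) ∘ θ_T = tch(c⁻¹,b⁻¹,a⁻¹)`):
**`mult (D′ x y) ζ = [ζ = tch(x, yν½⁻¹, yν½)] + [ζ = tch(yν½⁻¹, x, yν½)] + [ζ = tch(yν½⁻¹, yν½, x)]`** (`finrank_weightSpace_D'_eq`), and `r_U(D′(x,y))` is finite-dimensional.
For K2E3-p17's `D‴ = Ind_{Q′}(aν ⊗ ηdet₂)` (`x = aν`, `y = η`, `a = ην½⁻¹`): `E(D‴) = {(aν,a,aν), (a,aν,aν), (a,aν,aν)} = {Y, X, X}`.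

HONEST LABEL: HC_CM is proved only modulo the 7 printed citations (2 remaining named inputs: hLiu418 = stmt-HodgeConjecture-24832, h413 = stmt-HodgeConjecture-24833) until rung 0
closes; count-neutral helper.

## References
* [BernsteinZelevinsky1977] I. N. Bernstein, A. V. Zelevinsky, *Induced representations of reductive p-adic groups I*, Ann. Sci. ÉNS 10 (1977), §2.12, Thm. 5.2.
* [Zelevinsky1980] A. V. Zelevinsky, *Induced representations of reductive p-adic groups II*, Ann. Sci. ÉNS 13 (1980), §1.1, §1.2, Ex. 3.2.
-/

set_option autoImplicit false
set_option linter.dupNamespace false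

noncomputable section

open Function Representation Module Module.End
open scoped MatrixGroups
open Literature.NumberTheory.Automorphic Literature.NumberTheory.Automorphic.Zelevinsky1980
open Literature.NumberTheory.GaloisRepresentations Literature.NumberTheory.GaloisRepresentations.IsNonarchimedeanLocalField
open Summit.HodgeConjecture.HodgeConjecture.Cruxes.H413.K2E3JacquetWeightTransport
open Summit.HodgeConjecture.HodgeConjecture.Cruxes.H413.K2E3GL3StandardModuleTransport

namespace Summit.HodgeConjecture.HodgeConjecture.Cruxes.H413.K2E3GL3StandardModuleJacquetDimensionPrime

variable {F : Type} [Field F] [ValuativeRel F] [TopologicalSpace F] [IsNonarchimedeanLocalField F]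

omit [ValuativeRel F] [TopologicalSpace F] [IsNonarchimedeanLocalField F] in
/-- Precomposition with an involution: `ζ ∘ g = f ↔ ζ = f ∘ g`. [folklore] -/
theorem comp_eq_iff_eq_comp_of_involutive {T : Type*} {g : T → T} (hg : ∀ t, g (g t) = t) (ζ f : T → ℂ) :
    (fun t => ζ (g t)) = f ↔ ζ = fun t => f (g t) := by
  constructor
  · intro h
    funext t
    have ht := congrFun h (g t)
    simp only [hg] at ht
    exact ht
  · intro h
    funext t
    rw [h]
    exact congrArg f (hg t)

/-- Inverses of `y⁻¹ν½⁻¹`, `y⁻¹ν½`, `x⁻¹` in the commutative group `Fˣ →* ℂˣ`. [folklore] -/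
theorem inv_triples (x y : Fˣ →* ℂˣ) :
    (y⁻¹ * ((unramifiedTwist F (1 / 2) : QuasiChar F).toMonoidHom)⁻¹)⁻¹ = y * ((unramifiedTwist F (1 / 2) : QuasiChar F).toMonoidHom) ∧ (y⁻¹ * ((unramifiedTwist F (1 / 2) : QuasiChar F).toMonoidHom))⁻¹ = y * ((unramifiedTwist F (1 / 2) : QuasiChar F).toMonoidHom)⁻¹ ∧ (x⁻¹)⁻¹ = x := by
  refine ⟨MonoidHom.ext fun t => ?_, MonoidHom.ext fun t => ?_, inv_inv x⟩ <;>
    simp only [MonoidHom.inv_apply, MonoidHom.mul_apply, mul_inv_rev, inv_inv] <;> exact mul_comm _ _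

open scoped Classical in
/-- **BRICK GEO-QB‴ — THE EXPONENT TABLE OF `D′(x,y) = Ind_{P₁₂}((x ⊠ y∘det₂)δ^{1∕2})` AS A SUM OF THREE INDICATORS**: for characters `x, y` with open kernels and every
`ζ : T → ℂ`, `mult (D′ x y) ζ = [ζ = tch(x, yν½⁻¹, yν½)] + [ζ = tch(yν½⁻¹, x, yν½)] + [ζ = tch(yν½⁻¹, yν½, x)]` (the shape of ★ GEO-QB `finrank_weightSpace_D_eq`;
`D′ x y = parabolicIndGL F ![f,t,t] (𝟙.twist ψ_{Q′}(x,y))`, ★ WH0‴ currency).  Transport (★ (T-a), ★ part 1) of ★ GEO-QB at `(y⁻¹, x⁻¹)`.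
[cite: BernsteinZelevinsky1977, §2.12, Thm. 5.2] [cite: Zelevinsky1980, §1.1, §1.2, Ex. 3.2] -/
theorem finrank_weightSpace_D'_eq (x y : Fˣ →* ℂˣ) (hx : IsOpen ((x.ker : Subgroup Fˣ) : Set Fˣ)) (hy : IsOpen ((y.ker : Subgroup Fˣ) : Set Fˣ))
    (ζ : (Π a : Fin 3, GL {i : Fin 3 // (id : Fin 3 → Fin 3) i = a} F) → ℂ) :
    finrank ℂ ↥(⨅ m, Module.End.maxGenEigenspace (Representation.normalizedJacquetGL F (id : Fin 3 → Fin 3) (Representation.parabolicIndGL F (![false, true, true] : Fin 3 → Bool) ((Representation.trivial ℂ (Π a : Bool, GL {i : Fin 3 // (![false, true, true] : Fin 3 → Bool) i = a} F) ℂ).twist ((x.comp (Matrix.GeneralLinearGroup.det.comp (Pi.evalMonoidHom (fun a : Bool => GL {i : Fin 3 // (![false, true, true] : Fin 3 → Bool) i = a} F) false))) * (y.comp (Matrix.GeneralLinearGroup.det.comp (Pi.evalMonoidHom (fun a : Bool => GL {i : Fin 3 // (![false, true, true] : Fin 3 → Bool) i = a} F) true)))))) m) (ζ m)) =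
      (if ζ = fun m => (((∏ a : Fin 3, ((![x, y * ((unramifiedTwist F (1 / 2) : QuasiChar F).toMonoidHom)⁻¹, y * ((unramifiedTwist F (1 / 2) : QuasiChar F).toMonoidHom)] : Fin 3 → (Fˣ →* ℂˣ)) a).comp (Matrix.GeneralLinearGroup.det.comp (Pi.evalMonoidHom (fun a : Fin 3 => GL {i : Fin 3 // (id : Fin 3 → Fin 3) i = a} F) a))) m : ℂˣ) : ℂ) then 1 else 0) +
      (if ζ = fun m => (((∏ a : Fin 3, ((![y * ((unramifiedTwist F (1 / 2) : QuasiChar F).toMonoidHom)⁻¹, x, y * ((unramifiedTwist F (1 / 2) : QuasiChar F).toMonoidHom)] : Fin 3 → (Fˣ →* ℂˣ)) a).comp (Matrix.GeneralLinearGroup.det.comp (Pi.evalMonoidHom (fun a : Fin 3 => GL {i : Fin 3 // (id : Fin 3 → Fin 3) i = a} F) a))) m : ℂˣ) : ℂ) then 1 else 0) +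
      (if ζ = fun m => (((∏ a : Fin 3, ((![y * ((unramifiedTwist F (1 / 2) : QuasiChar F).toMonoidHom)⁻¹, y * ((unramifiedTwist F (1 / 2) : QuasiChar F).toMonoidHom), x] : Fin 3 → (Fˣ →* ℂˣ)) a).comp (Matrix.GeneralLinearGroup.det.comp (Pi.evalMonoidHom (fun a : Fin 3 => GL {i : Fin 3 // (id : Fin 3 → Fin 3) i = a} F) a))) m : ℂˣ) : ℂ) then 1 else 0) := by
  have hx' : IsOpen ((x⁻¹.ker : Subgroup Fˣ) : Set Fˣ) := by rw [K2E3GL3StandardModuleEmbedding.ker_inv_eq_ker]; exact hx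
  have hy' : IsOpen ((y⁻¹.ker : Subgroup Fˣ) : Set Fˣ) := by rw [K2E3GL3StandardModuleEmbedding.ker_inv_eq_ker]; exact hy
  have hΦ' := exists_transportEquiv_D' (F := F) x y
  obtain ⟨Φ, hΦ⟩ := hΦ'
  have h1 := finrank_weightSpace_eq_of_gkAutomorphism (Representation.parabolicIndGL F (![false, true, true] : Fin 3 → Bool) ((Representation.trivial ℂ (Π a : Bool, GL {i : Fin 3 // (![false, true, true] : Fin 3 → Bool) i = a} F) ℂ).twist ((x.comp (Matrix.GeneralLinearGroup.det.comp (Pi.evalMonoidHom (fun a : Bool => GL {i : Fin 3 // (![false, true, true] : Fin 3 → Bool) i = a} F) false))) * (y.comp (Matrix.GeneralLinearGroup.det.comp (Pi.evalMonoidHom (fun a : Bool => GL {i : Fin 3 // (![false, true, true] : Fin 3 → Bool) i = a} F) true)))))) (Representation.parabolicIndGL F (![false, false, true] : Fin 3 → Bool) ((Representation.trivial ℂ (Π a : Bool, GL {i : Fin 3 // (![false, false, true] : Fin 3 → Bool) i = a} F) ℂ).twist ((y⁻¹.comp (Matrix.GeneralLinearGroup.det.comp (Pi.evalMonoidHom (fun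 a : Bool => GL {i : Fin 3 // (![false, false, true] : Fin 3 → Bool) i = a} F) false))) * (x⁻¹.comp (Matrix.GeneralLinearGroup.det.comp (Pi.evalMonoidHom (fun a : Bool => GL {i : Fin 3 // (![false, false, true] : Fin 3 → Bool) i = a} F) true)))))) Φ hΦ ζ
  have h2 := K2E3GL3StandardModuleJacquetDimension.finrank_weightSpace_D_eq y⁻¹ x⁻¹ hy' hx' (fun m => ζ (leviProjection F (id : Fin 3 → Fin 3) ⟨gkAutomorphism (blockDiagonalGL F (id : Fin 3 → Fin 3) m), (K2E3GL3WeakCellLemmaTransport.gkAutomorphism_mem_borel_iff F _).2 (blockDiagonalGL_mem (id : Fin 3 → Fin 3) m)⟩))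
  beta_reduce at h2
  rw [h1, h2]
  have hinv : ∀ m : (Π a : Fin 3, GL {i : Fin 3 // (id : Fin 3 → Fin 3) i = a} F), (leviProjection F (id : Fin 3 → Fin 3) ⟨gkAutomorphism (blockDiagonalGL F (id : Fin 3 → Fin 3) (leviProjection F (id : Fin 3 → Fin 3) ⟨gkAutomorphism (blockDiagonalGL F (id : Fin 3 → Fin 3) m), (K2E3GL3WeakCellLemmaTransport.gkAutomorphism_mem_borel_iff F _).2 (blockDiagonalGL_mem (id : Fin 3 → Fin 3) m)⟩)),
      (K2E3GL3WeakCellLemmaTransport.gkAutomorphism_mem_borel_iff F _).2 (blockDiagonalGL_mem (id : Fin 3 → Fin 3) _)⟩) = m := fun m =>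
    leviAut_leviAut F (id : Fin 3 → Fin 3) (gkAutomorphism : GL (Fin 3) F ≃ₜ* GL (Fin 3) F) (K2E3GL3OuterAutomorphismInduction.gkAutomorphism_gkAutomorphism F)
      (K2E3GL3WeakCellLemmaTransport.gkAutomorphism_mem_borel_iff F) gkAutomorphism_mem_unipotentRadicalP_borel m
  obtain ⟨i1, i2, i3⟩ := inv_triples x y
  have e1 : ((fun m : (Π a : Fin 3, GL {i : Fin 3 // (id : Fin 3 → Fin 3) i = a} F) => ζ (leviProjection F (id : Fin 3 → Fin 3) ⟨gkAutomorphism (blockDiagonalGL F (id : Fin 3 → Fin 3) m), (K2E3GL3WeakCellLemmaTransport.gkAutomorphism_mem_borel_iff F _).2 (blockDiagonalGL_mem (id : Fin 3 → Fin 3) m)⟩)) = fun m => (((∏ a : Fin 3, ((![y⁻¹ * ((unramifiedTwist F (1 / 2) : QuasiChar F).toMonoidHom)⁻¹, y⁻¹ * ((unramifiedTwist F (1 / 2) : QuasiChar F).toMonoidHom), x⁻¹] : Fin 3 → (Fˣ →* ℂˣ)) a).comp (Matrix.GeneralLinearGroup.det.comp (Pi.evalMonoidHom (fun a : Fin 3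 => GL {i : Fin 3 // (id : Fin 3 → Fin 3) i = a} F) a))) m : ℂˣ) : ℂ)) ↔ ζ = fun m => (((∏ a : Fin 3, ((![x, y * ((unramifiedTwist F (1 / 2) : QuasiChar F).toMonoidHom)⁻¹, y * ((unramifiedTwist F (1 / 2) : QuasiChar F).toMonoidHom)] : Fin 3 → (Fˣ →* ℂˣ)) a).comp (Matrix.GeneralLinearGroup.det.comp (Pi.evalMonoidHom (fun a : Fin 3 => GL {i : Fin 3 // (id : Fin 3 → Fin 3) i = a} F) a))) m : ℂˣ) : ℂ) := by
    rw [comp_eq_iff_eq_comp_of_involutive hinv, tch_comp_leviAut_gkAutomorphism]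
    simp only [Matrix.cons_val_zero, Matrix.cons_val_one, Matrix.head_cons, Matrix.cons_val_two, Matrix.tail_cons, i1, i2, i3]
  have e2 : ((fun m : (Π a : Fin 3, GL {i : Fin 3 // (id : Fin 3 → Fin 3) i = a} F) => ζ (leviProjection F (id : Fin 3 → Fin 3) ⟨gkAutomorphism (blockDiagonalGL F (id : Fin 3 → Fin 3) m), (K2E3GL3WeakCellLemmaTransport.gkAutomorphism_mem_borel_iff F _).2 (blockDiagonalGL_mem (id : Fin 3 → Fin 3) m)⟩)) = fun m => (((∏ a : Fin 3, ((![y⁻¹ * ((unramifiedTwist F (1 / 2) : QuasiChar F).toMonoidHom)⁻¹, x⁻¹, y⁻¹ * ((unramifiedTwist F (1 / 2) : QuasiChar F).toMonoidHom)] : Fin 3 → (Fˣ →* ℂˣ)) a).comp (Matrix.GeneralLinearGroup.det.comp (Pi.evalMonoidHom (fun a : Fin 3 => GL {i : Fin 3 // (id : Fin 3 → Fin 3) i = a} F) a))) m : ℂˣ) : ℂ)) ↔ ζ = fun m => (((∏ a : Fin 3, ((![y * ((unramifiedTwist F (1 / 2) : QuasiChar F).toMonoidHom)⁻¹, x, y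 * ((unramifiedTwist F (1 / 2) : QuasiChar F).toMonoidHom)] : Fin 3 → (Fˣ →* ℂˣ)) a).comp (Matrix.GeneralLinearGroup.det.comp (Pi.evalMonoidHom (fun a : Fin 3 => GL {i : Fin 3 // (id : Fin 3 → Fin 3) i = a} F) a))) m : ℂˣ) : ℂ) := by
    rw [comp_eq_iff_eq_comp_of_involutive hinv, tch_comp_leviAut_gkAutomorphism]
    simp only [Matrix.cons_val_zero, Matrix.cons_val_one, Matrix.head_cons, Matrix.cons_val_two, Matrix.tail_cons, i1, i2, i3]
  have e3 : ((fun m : (Π a : Fin 3, GL {i : Fin 3 // (id : Fin 3 → Fin 3) i = a} F) => ζ (leviProjection F (id : Fin 3 → Fin 3) ⟨gkAutomorphism (blockDiagonalGL F (id : Fin 3 → Fin 3) m), (K2E3GL3WeakCellLemmaTransport.gkAutomorphism_mem_borel_iff F _).2 (blockDiagonalGL_mem (id : Fin 3 → Fin 3) m)⟩)) = fun m => (((∏ a : Fin 3, ((![x⁻¹, y⁻¹ * ((unramifiedTwist F (1 / 2) : QuasiChar F).toMonoidHom)⁻¹, y⁻¹ * ((unramifiedTwist F (1 / 2) : QuasiChar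 F).toMonoidHom)] : Fin 3 → (Fˣ →* ℂˣ)) a).comp (Matrix.GeneralLinearGroup.det.comp (Pi.evalMonoidHom (fun a : Fin 3 => GL {i : Fin 3 // (id : Fin 3 → Fin 3) i = a} F) a))) m : ℂˣ) : ℂ)) ↔ ζ = fun m => (((∏ a : Fin 3, ((![y * ((unramifiedTwist F (1 / 2) : QuasiChar F).toMonoidHom)⁻¹, y * ((unramifiedTwist F (1 / 2) : QuasiChar F).toMonoidHom), x] : Fin 3 → (Fˣ →* ℂˣ)) a).comp (Matrix.GeneralLinearGroup.det.comp (Pi.evalMonoidHom (fun a : Fin 3 => GL {i : Fin 3 // (id : Fin 3 → Fin 3) i = a} F) a))) m : ℂˣ) : ℂ) := by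
    rw [comp_eq_iff_eq_comp_of_involutive hinv, tch_comp_leviAut_gkAutomorphism]
    simp only [Matrix.cons_val_zero, Matrix.cons_val_one, Matrix.head_cons, Matrix.cons_val_two, Matrix.tail_cons, i1, i2, i3]
  simp only [e1, e2, e3]

/-- `r_U(D′(x,y))` is finite-dimensional (transport of ★ `finiteDimensional_jacquet_D` along (T-a)). [cite: BernsteinZelevinsky1977, §2.12, Thm. 5.2] -/
theorem finiteDimensional_jacquet_D' (x y : Fˣ →* ℂˣ) (hx : IsOpen ((x.ker : Subgroup Fˣ) : Set Fˣ)) (hy : IsOpen ((y.ker : Subgroup Fˣ) : Set Fˣ)) :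
    FiniteDimensional ℂ (Representation.restrictUnipotentGL F (id : Fin 3 → Fin 3) (Representation.parabolicIndGL F (![false, true, true] : Fin 3 → Bool) ((Representation.trivial ℂ (Π a : Bool, GL {i : Fin 3 // (![false, true, true] : Fin 3 → Bool) i = a} F) ℂ).twist ((x.comp (Matrix.GeneralLinearGroup.det.comp (Pi.evalMonoidHom (fun a : Bool => GL {i : Fin 3 // (![false, true, true] : Fin 3 → Bool) i = a} F) false))) * (y.comp (Matrix.GeneralLinearGroup.det.comp (Pi.evalMonoidHom (fun a : Bool => GL {i : Fin 3 // (![false, true, true] : Fin 3 → Bool) i = a} F) true))))))).Coinvariants := by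
  have hx' : IsOpen ((x⁻¹.ker : Subgroup Fˣ) : Set Fˣ) := by rw [K2E3GL3StandardModuleEmbedding.ker_inv_eq_ker]; exact hx
  have hy' : IsOpen ((y⁻¹.ker : Subgroup Fˣ) : Set Fˣ) := by rw [K2E3GL3StandardModuleEmbedding.ker_inv_eq_ker]; exact hy
  haveI := K2E3GL3StandardModuleJacquetDimension.finiteDimensional_jacquet_D y⁻¹ x⁻¹ hy' hx'
  have hΦ' := exists_transportEquiv_D' (F := F) x y
  obtain ⟨Φ, hΦ⟩ := hΦ'
  have hker := K2E3JacquetModuleAutomorphismTransport.map_coinvariantsKer_eq F (id : Fin 3 → Fin 3) (id : Fin 3 → Fin 3)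
    (gkAutomorphism : GL (Fin 3) F ≃ₜ* GL (Fin 3) F) (K2E3GL3OuterAutomorphismInduction.gkAutomorphism_gkAutomorphism F)
    (K2E3GL3WeakCellLemmaTransport.gkAutomorphism_mem_borel_iff F) (K2E3GL3WeakCellLemmaTransport.gkAutomorphism_mem_borel_iff F)
    gkAutomorphism_mem_unipotentRadicalP_borel gkAutomorphism_mem_unipotentRadicalP_borel (Representation.parabolicIndGL F (![false, true, true] : Fin 3 → Bool) ((Representation.trivial ℂ (Π a : Bool, GL {i : Fin 3 // (![false, true, true] : Fin 3 → Bool) i = a} F) ℂ).twist ((x.comp (Matrix.GeneralLinearGroup.det.comp (Pi.evalMonoidHom (fun a : Bool => GL {i : Fin 3 // (![false, true, true] : Fin 3 → Bool) i = a} F) false))) * (y.comp (Matrix.GeneralLinearGroup.det.comp (Pi.evalMonoidHom (fun a : Bool => GL {i : Fin 3 // (![false, true, true] : Fin 3 → Bool) i = a} F) true)))))) (Representation.parabolicIndGL F (![false, false, true] : Fin 3 → Bool) ((Representation.trivial ℂ (Π a : Bool, GL {i : Fin 3 // (![false, false, true] : Fin 3 → Bool) i = a} F) ℂ).twist ((y⁻¹.comp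 (Matrix.GeneralLinearGroup.det.comp (Pi.evalMonoidHom (fun a : Bool => GL {i : Fin 3 // (![false, false, true] : Fin 3 → Bool) i = a} F) false))) * (x⁻¹.comp (Matrix.GeneralLinearGroup.det.comp (Pi.evalMonoidHom (fun a : Bool => GL {i : Fin 3 // (![false, false, true] : Fin 3 → Bool) i = a} F) true)))))) Φ hΦ
  let L : (Representation.restrictUnipotentGL F (id : Fin 3 → Fin 3) (Representation.parabolicIndGL F (![false, true, true] : Fin 3 → Bool) ((Representation.trivial ℂ (Π a : Bool, GL {i : Fin 3 // (![false, true, true] : Fin 3 → Bool) i = a} F) ℂ).twist ((x.comp (Matrix.GeneralLinearGroup.det.comp (Pi.evalMonoidHom (fun a : Bool => GL {i : Fin 3 // (![false, true, true] : Fin 3 → Bool) i = a} F) false))) * (y.comp (Matrix.GeneralLinearGroup.det.comp (Pi.evalMonoidHom (fun a : Bool => GL {i : Fin 3 // (![false, true, true] : Fin 3 → Bool) i = a} F) true))))))).Coinvariants ≃ₗ[ℂ]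
      (Representation.restrictUnipotentGL F (id : Fin 3 → Fin 3) (Representation.parabolicIndGL F (![false, false, true] : Fin 3 → Bool) ((Representation.trivial ℂ (Π a : Bool, GL {i : Fin 3 // (![false, false, true] : Fin 3 → Bool) i = a} F) ℂ).twist ((y⁻¹.comp (Matrix.GeneralLinearGroup.det.comp (Pi.evalMonoidHom (fun a : Bool => GL {i : Fin 3 // (![false, false, true] : Fin 3 → Bool) i = a} F) false))) * (x⁻¹.comp (Matrix.GeneralLinearGroup.det.comp (Pi.evalMonoidHom (fun a : Bool => GL {i : Fin 3 // (![false, false, true] : Fin 3 → Bool) i = a} F) true))))))).Coinvariants := Submodule.Quotient.equiv _ _ Φ hker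
  exact LinearEquiv.finiteDimensional L.symm

end Summit.HodgeConjecture.HodgeConjecture.Cruxes.H413.K2E3GL3StandardModuleJacquetDimensionPrime

end
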